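import Literature.Geometry.Lorentzian.CauchyHypersurfaceCausalProofs
import Literature.Geometry.Lorentzian.CauchyHypersurfaceRetraction
import Literature.Geometry.Lorentzian.AchronalBoundaryProofs
import Literature.Geometry.Lorentzian.CausalityPushUp
import Mathlib.Analysis.Normed.Module.HahnBanach
import HarnessLib

/-!
# Open pieces of a spacelike Cauchy hypersurface do not touch `closure (I±(S ∖ A))`

The local half of the theorem "the Cauchy development of an open piece `A` of a spacelike Cauchy
hypersurface `S` is an open globally hyperbolic region with Cauchy hypersurface `A`"
(Hawking–Ellis 1973, §6.5–6.6, Prop. 6.6.3; O'Neill 1983, Ch. 14, Thm. 14.38, Lemma 14.43): the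
hypothesis `Disjoint A (closure (I⁺(S ∖ A) ∪ I⁻(S ∖ A) ∪ (S ∖ A)))` of
`IsCauchyHypersurface.restrict_compl_closure` (`CauchyPieceDomain.lean`). For merely achronal
`S` it fails (a null segment of `S` through a point of `A`); it holds as soon as `S` is
*spacelike at the points of `A`* in the following first-order sense, and `A` is relatively open:

* `LorentzianMetric.not_mem_closure_chronologicalFuture_sdiff` — if `S` is a Cauchy hypersurface,
  `a ∈ S`, `ν ∈ T_aM` is future timelike, all points of `S` near `a` lie in `A`, and in the chart
  `φ = extChartAt I a` one has `|g_a(ν, φ σ - φ a)| ≤ κ ‖φ σ - φ a‖` for every `κ > 0` and all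
  `σ ∈ S` near `a` (`S` is tangent at `a` to `ν^⊥`), then `a ∉ closure (I⁺(S ∖ A))`;
* `LorentzianMetric.not_mem_closure_chronologicalPast_sdiff` — time dual;
* `LorentzianMetric.IsCauchyHypersurface.disjoint_closure_of_spacelike` — the disjointness, for
  `A ⊆ S` relatively open and such a `ν_a` at every `a ∈ A` (for the image of a data embedding the
  slab condition is `DataEmbedding.eventually_abs_val_normal_le`, `CauchyDevelopmentPieceDomain`);
* `LorentzianMetric.IsCauchyHypersurface.false_of_isFutureCausalCurveOn_of_spacelike` — a Cauchy
  hypersurface which is spacelike (slab condition) at each of its points is **acausal**: no future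
  causal curve on `[a, b]`, `a < b`, starts and ends on it (O'Neill 1983, Ch. 14, p. 425).

Tools: `cone_estimate_of_hasDerivAt` (a cone condition `c ‖ẋ‖ ≤ ℓ(ẋ)` integrates to
`c ‖x(s₂) - x(s₁)‖ ≤ ℓ(x(s₂) - x(s₁))`, by a norming functional — Hahn–Banach),
`IsCauchyHypersurface.exists_mem_of_segment` (a timelike segment from `I⁻(S)` to `I⁺(S)` meets the
Cauchy hypersurface `S`), `symmL_trivializationAt_base` (the tangent trivialisation at its base
point is the identity).

**Proof of the main theorem** (chart at `a`, no limit curves). Let `ℓ = -g_a(ν, ·)`; by the uniform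
cone constant (`PushUp.exists_cone_const`, `CausalityPushUp.lean`) and continuity of the metric
read in the chart there are `c > 0` and a chart ball about `a` on which `c ‖v̂‖ ≤ ℓ(v̂)` for every
future causal vector, and on which the vertical chart lines (direction `ν`) are timelike
(`chartCone`). Choose `κ ≪ c`, then radii `r₂` (slab and relative openness), `R` (vertical search
range), `r₁ = r₀ R / 2` (a closed chart ball `K` about `a`) and `δ ≪ r₁`. If `p ∈ I⁺(b)`,
`b ∈ S ∖ A`, with `‖φ p - φ a‖ < δ`, the timelike curve from `b` (outside `K`) to `p` (inside)
enters `K` a last time at `e`, `‖φ e - φ a‖ = r₁`; integrating the cone condition along the final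
arc, `ℓ(φ e - φ a) ≤ -c r₁ / 2`. The vertical chart segment through `e` of half-length `R` starts in
`I⁻(a)` and ends in `I⁺(a)` (tilted straight chart segments from/to `φ a` are timelike), hence
crosses `S` at `σ = φ⁻¹(φ e + t_e ν)`; the slab at `σ` gives `t_e ℓ(ν) ≥ c r₁ / 2 - κ R Λ > 0`,
so `t_e > 0` and `e ≪ σ`; with `b ≪ e` (or `b = e`) we get `b ≪ σ`, two chronologically related
points of the achronal set `S` — contradiction.

Everything is proved; no definitions, no named facts (D-0026).

## References

* S. W. Hawking, G. F. R. Ellis, *The large scale structure of space-time*, CUP 1973, §6.5,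
  §6.6, Prop. 6.6.3. [HawkingEllis1973CUP]
* B. O'Neill, *Semi-Riemannian geometry with applications to relativity*, Academic Press 1983,
  Ch. 14, Thm. 14.38, Lemma 14.43 (pp. 423–426); Ch. 5, Lemma 5.26 ff. [ONeillSemiRiemannian1983]
-/

noncomputable section

open Bundle Set Filter Function Topology
open scoped Manifold ContDiff Topology

namespace Literature.Geometry.Lorentzian

/-! ### A normed-space lemma: integrating a cone condition along a curve -/

section Normed

variable {F : Type*} [NormedAddCommGroup F] [NormedSpace ℝ F]

/-- **Integrated cone estimate.** If the curve `x` has derivative `w s` at every `s ∈ [s₁, s₂]`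
and `c ‖w s‖ ≤ ℓ (w s)` for a continuous linear functional `ℓ`, then
`c ‖x s₂ - x s₁‖ ≤ ℓ (x s₂ - x s₁)`: for a norming functional `μ` of `x s₂ - x s₁` (Hahn–Banach)
the function `ℓ ∘ x - c μ ∘ x` has nonnegative derivative. [folklore] -/
theorem cone_estimate_of_hasDerivAt {ℓ : F →L[ℝ] ℝ} {c : ℝ} (hc : 0 ≤ c) {x w : ℝ → F}
    {s₁ s₂ : ℝ} (hs : s₁ ≤ s₂) (hx : ∀ s ∈ Icc s₁ s₂, HasDerivAt x (w s) s)
    (hw : ∀ s ∈ Icc s₁ s₂, c * ‖w s‖ ≤ ℓ (w s)) :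
    c * ‖x s₂ - x s₁‖ ≤ ℓ (x s₂ - x s₁) := by
  obtain ⟨μ, hμ1, hμx⟩ := exists_dual_vector'' ℝ (x s₂ - x s₁)
  set f : ℝ → ℝ := fun s ↦ ℓ (x s) - c * μ (x s) with hf
  have hf' : ∀ s ∈ Icc s₁ s₂, HasDerivAt f (ℓ (w s) - c * μ (w s)) s := fun s hs ↦
    (ℓ.hasFDerivAt.comp_hasDerivAt s (hx s hs)).sub
      ((μ.hasFDerivAt.comp_hasDerivAt s (hx s hs)).const_mul c)
  have hnonneg : ∀ s ∈ Icc s₁ s₂, 0 ≤ ℓ (w s) - c * μ (w s) := by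
    intro s hs
    have h1 : μ (w s) ≤ ‖w s‖ := by
      have h := μ.le_opNorm (w s)
      have h' : ‖μ (w s)‖ ≤ ‖w s‖ := h.trans (by nlinarith [norm_nonneg (w s)])
      exact (le_abs_self _).trans (Real.norm_eq_abs _ ▸ h')
    nlinarith [hw s hs]
  have hmono : MonotoneOn f (Icc s₁ s₂) := by
    refine monotoneOn_of_deriv_nonneg (convex_Icc s₁ s₂)
      (fun s hs ↦ (hf' s hs).continuousAt.continuousWithinAt) (fun s hs ↦ ?_) (fun s hs ↦ ?_)
    · rw [interior_Icc] at hs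
      exact (hf' s ⟨hs.1.le, hs.2.le⟩).differentiableAt.differentiableWithinAt
    · rw [interior_Icc] at hs
      rw [(hf' s ⟨hs.1.le, hs.2.le⟩).deriv]
      exact hnonneg s ⟨hs.1.le, hs.2.le⟩
  have h := hmono (left_mem_Icc.2 hs) (right_mem_Icc.2 hs) hs
  simp only [hf] at h
  have hμ' : μ (x s₂ - x s₁) = ‖x s₂ - x s₁‖ := by exact_mod_cast hμx
  rw [map_sub] at hμ' ⊢
  nlinarith [hμ', h]

end Normed

variable {E : Type*} [NormedAddCommGroup E] [NormedSpace ℝ E] {H : Type*} [TopologicalSpace H]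
  {I : ModelWithCorners ℝ E H} {n : ℕ∞ω} {M : Type*} [TopologicalSpace M] [ChartedSpace H M]
  [IsManifold I ∞ M]

/-! ### The tangent trivialization at the base point is the identity -/

omit [IsManifold I ∞ M] in
/-- The trivialisation of `TM` at `a`, read at `a` itself, is the identity. [folklore] -/
theorem continuousLinearMapAt_trivializationAt_base [IsManifold I 1 M] (a : M)
    (v : TangentSpace I a) :
    (trivializationAt E (TangentSpace I) a).continuousLinearMapAt ℝ a v = v := by
  rw [TangentBundle.continuousLinearMapAt_trivializationAt (mem_chart_source H a),
    mfderiv_extChartAt_self]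
  rfl

omit [IsManifold I ∞ M] in
/-- The inverse trivialisation of `TM` at `a`, read at `a` itself, is the identity. [folklore] -/
theorem symmL_trivializationAt_base [IsManifold I 1 M] (a : M) (w : E) :
    (trivializationAt E (TangentSpace I) a).symmL ℝ a w = w := by
  have h := (trivializationAt E (TangentSpace I) a).symmL_continuousLinearMapAt (R := ℝ)
    (FiberBundle.mem_baseSet_trivializationAt' a) w
  rwa [continuousLinearMapAt_trivializationAt_base] at h

namespace LorentzianMetric

variable {g : LorentzianMetric I n M} {τ : TimeOrientation g}

/-! ### A timelike segment from `I⁻(S)` to `I⁺(S)` crosses the Cauchy hypersurface `S` -/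

/-- **Crossing lemma.** A future timelike curve on `[a, b]` which starts in `I⁻(S)` and ends in
`I⁺(S)` meets the Cauchy hypersurface `S` (its image is connected and `M ∖ S = I⁺(S) ⊔ I⁻(S)`).
O'Neill 1983, Ch. 14, Lemma 14.29 (p. 415). [cite: ONeillSemiRiemannian1983, Ch. 14, Lemma 14.29 (p. 415)] -/
theorem IsCauchyHypersurface.exists_mem_of_segment [T2Space M] [SecondCountableTopology M]
    [BoundarylessManifold I M] [FiniteDimensional ℝ E] (hn : 2 ≤ n) {S : Set M}
    (hS : g.IsCauchyHypersurface τ S) {V : ℝ → M} {a b : ℝ} (hab : a ≤ b)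
    (hV : g.IsFutureTimelikeCurveOn τ V (Icc a b)) (ha : V a ∈ g.chronologicalPast τ S)
    (hb : V b ∈ g.chronologicalFuture τ S) : ∃ t ∈ Icc a b, V t ∈ S := by
  by_contra hmiss
  push Not at hmiss
  have hA : g.IsAchronal τ S := IsCauchyHypersurface.isAchronal_holds hn hS
  have hdisj : Disjoint (g.chronologicalFuture τ S) (g.chronologicalPast τ S) :=
    Set.disjoint_left.2 fun _ hy ↦ hA.not_mem_chronologicalPast_of_mem_chronologicalFuture hy
  have himg : V '' Icc a b ⊆ g.chronologicalFuture τ S ∪ g.chronologicalPast τ S := by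
    rintro _ ⟨t, ht, rfl⟩
    exact hS.mem_chronologicalFuture_union_chronologicalPast hn (hmiss t ht)
  have hconn : IsPreconnected (V '' Icc a b) :=
    isPreconnected_Icc.image V fun t ht ↦ (hV t ht).1.continuousAt.continuousWithinAt
  rcases hconn.subset_or_subset (isOpen_chronologicalFuture_of_boundaryless g τ S)
    (isOpen_chronologicalPast_of_boundaryless g τ S) hdisj himg with h | h
  · exact Set.disjoint_left.1 hdisj (h (mem_image_of_mem V (left_mem_Icc.2 hab))) ha
  · exact Set.disjoint_left.1 hdisj hb (h (mem_image_of_mem V (right_mem_Icc.2 hab)))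

/-! ### The main local theorem -/

section Main

variable [T2Space M] [SecondCountableTopology M] [BoundarylessManifold I M] [FiniteDimensional ℝ E]

/-- **An open piece of a spacelike Cauchy hypersurface does not touch the closure of
`I⁺(S ∖ A)`.** Let `S` be a Cauchy hypersurface, `a ∈ S`, `ν ∈ T_aM` future timelike, and suppose
(i) `A ⊆ M` contains all points of `S` near `a` (`hA`), and (ii) `S` is *tangent at `a` to the
hyperplane `ν^⊥`* in the chart `φ = extChartAt I a`: for every `κ > 0`,
`|g_a(ν, φ σ - φ a)| ≤ κ ‖φ σ - φ a‖` for all `σ ∈ S` near `a` (`hslab`; this holds when `S` is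
the image of an immersion with normal `ν` at `a`). Then `a ∉ closure (I⁺(S ∖ A))`.
Proof (in the chart at `a`; replaces the limit-curve proofs of the openness of `D(S)`,
O'Neill 1983, Lemma 14.43, Hawking–Ellis 1973, Prop. 6.5.1/6.6.?): with `ℓ = -g_a(ν, ·)` and a
uniform cone constant `c` (`exists_cone_const`: `c ‖v‖ ≤ ℓ v` for future causal `v` at nearby
points), `ℓ` increases at rate `≥ c ‖ẋ‖` along future causal curves near `a`
(`cone_estimate_of_hasDerivAt`). A timelike curve from `b ∈ S ∖ A` to a point `p` very close to
`a` enters the closed chart ball `K` of radius `r₁` about `a` a last time at a point `e` with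
`‖φ e - φ a‖ = r₁`, so `ℓ(φ e - φ a) ≤ -c r₁ / 2`; the vertical chart segment through `e` (direction
`ν`, timelike) runs from `I⁻(a)` to `I⁺(a)` and therefore crosses `S` (`exists_mem_of_segment`) at
a point `σ` with `|ℓ(φ σ - φ a)|` small (`hslab`), hence *above* `e`: `e ≪ σ`. But then
`b ≪ σ` with `b, σ ∈ S`, against the achronality of `S`.
[cite: ONeillSemiRiemannian1983, Ch. 14, Lemma 14.43 (p. 425); HawkingEllis1973CUP, §6.5] -/
theorem not_mem_closure_chronologicalFuture_sdiff (hn : 2 ≤ n) {S A : Set M}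
    (hS : g.IsCauchyHypersurface τ S) {a : M} (haS : a ∈ S) {ν : TangentSpace I a}
    (hνt : g.IsTimelike ν) (hνf : τ.IsFutureDirected ν)
    (hA : ∀ᶠ σ in 𝓝 a, σ ∈ S → σ ∈ A)
    (hslab : ∀ κ : ℝ, 0 < κ → ∀ᶠ σ in 𝓝 a, σ ∈ S →
      |g.val a ν (extChartAt I a σ - extChartAt I a a)| ≤
        κ * ‖extChartAt I a σ - extChartAt I a a‖) :
    a ∉ closure (g.chronologicalFuture τ (S \ A)) := by
  intro hcl
  -- notation and basic facts at `a`
  set φ := extChartAt I a with hφ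
  set x₀ : E := φ a with hx₀
  set eT := trivializationAt E (TangentSpace I) a with heT
  set T₀ : E := ν with hT₀
  have hn1 : (1 : ℕ∞ω) ≤ n := le_trans one_le_two hn
  have hAc : g.IsAchronal τ S := IsCauchyHypersurface.isAchronal_holds hn hS
  have hx₀t : x₀ ∈ φ.target := mem_extChartAt_target a
  have hx₀int : x₀ ∈ interior (range I) := BoundarylessManifold.isInteriorPoint (I := I) (M := M)
  have htarget : φ.target ∈ 𝓝 x₀ := by
    have hint : x₀ ∈ interior (extChartAt I a).target :=
      ModelWithCorners.isInteriorPoint_iff.mp (BoundarylessManifold.isInteriorPoint (I := I))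
    exact mem_interior_iff_mem_nhds.mp hint
  have hsymm₀ : φ.symm x₀ = a := extChartAt_to_inv a
  have hsrc₀ : a ∈ φ.source := mem_extChartAt_source a
  have hsrc_eq : φ.source = (chartAt H a).source := extChartAt_source I a
  have hid : ∀ w : E, eT.symmL ℝ a w = w := symmL_trivializationAt_base a
  have hG₀ : ∀ v w : E, g.coordMetric a x₀ v w = g.val a v w := by
    intro v w
    rw [g.coordMetric_apply hx₀t]
    rw [show (extChartAt I a).symm x₀ = a from hsymm₀, hid, hid]
  -- the functional `ℓ = -g_a(ν, ·)` and its basic properties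
  set ℓ : E →L[ℝ] ℝ := -(g.coordMetric a x₀ T₀) with hℓ_def
  have hℓ : ∀ w : E, ℓ w = -(g.val a ν w) := fun w ↦ by
    show -(g.coordMetric a x₀ T₀ w) = -(g.val a ν w)
    rw [hG₀]
  have hℓT₀ : 0 < ℓ T₀ := by rw [hℓ]; exact neg_pos.2 hνt
  -- Step 1: the uniform cone constant
  obtain ⟨c, hc, m, hm, hcone⟩ := PushUp.exists_cone_const (g.coordMetric a x₀) T₀ (fun v hv0 hvv hTv ↦ by
    rw [hG₀] at hvv hTv ⊢
    exact lt_of_le_of_ne hTv (g.val_ne_zero_of_isTimelike_of_isCausal hνt ⟨hvv, hv0⟩))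
  -- Step 2: a chart ball on which the metric is close and the vertical directions are timelike
  have hGc : ContinuousAt (g.coordMetric a) x₀ :=
    ((g.contDiffOn_coordMetric hn1 a).continuousOn.continuousWithinAt hx₀t).continuousAt htarget
  have hGT : ContinuousAt (fun x ↦ g.coordMetric a x T₀) x₀ := hGc.clm_apply continuousAt_const
  have hK₀ : (x₀, T₀) ∈ chartCone g τ a := by
    refine mem_chartCone_iff.mpr ⟨⟨hx₀t, hx₀int⟩, ?_⟩
    rw [show (extChartAt I a).symm x₀ = a from hsymm₀, hid]
    exact mem_futureTimecone_iff.mpr ⟨hνt, hνf⟩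
  obtain ⟨r₀, hr₀, hball₀⟩ : ∃ r₀ > 0, ∀ x : E, ‖x - x₀‖ < r₀ → x ∈ φ.target ∧
      ‖g.coordMetric a x - g.coordMetric a x₀‖ < m ∧
      ‖g.coordMetric a x T₀ - g.coordMetric a x₀ T₀‖ < m ∧
      ∀ u : E, ‖u - T₀‖ < r₀ → (x, u) ∈ chartCone g τ a := by
    obtain ⟨δ₁, hδ₁, hδ₁'⟩ := Metric.mem_nhds_iff.1 htarget
    obtain ⟨δ₂, hδ₂, hδ₂'⟩ : ∃ δ > 0, ∀ z : E, ‖z - x₀‖ < δ →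
        ‖g.coordMetric a z - g.coordMetric a x₀‖ < m :=
      (NormedAddCommGroup.tendsto_nhds_nhds (f := g.coordMetric a) (x := x₀)
        (y := g.coordMetric a x₀)).1 hGc.tendsto _ hm
    obtain ⟨δ₃, hδ₃, hδ₃'⟩ : ∃ δ > 0, ∀ z : E, ‖z - x₀‖ < δ →
        ‖g.coordMetric a z T₀ - g.coordMetric a x₀ T₀‖ < m :=
      (NormedAddCommGroup.tendsto_nhds_nhds (f := fun x ↦ g.coordMetric a x T₀)
        (x := x₀) (y := g.coordMetric a x₀ T₀)).1 hGT.tendsto _ hm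
    obtain ⟨ε, hε, hεK⟩ := Metric.isOpen_iff.1 (isOpen_chartCone g τ a) _ hK₀
    refine ⟨min (min δ₁ δ₂) (min δ₃ ε), lt_min (lt_min hδ₁ hδ₂) (lt_min hδ₃ hε), fun x hx ↦ ?_⟩
    have hx1 : ‖x - x₀‖ < δ₁ := hx.trans_le ((min_le_left _ _).trans (min_le_left _ _))
    have hx2 : ‖x - x₀‖ < δ₂ := hx.trans_le ((min_le_left _ _).trans (min_le_right _ _))
    have hx3 : ‖x - x₀‖ < δ₃ := hx.trans_le ((min_le_right _ _).trans (min_le_left _ _))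
    have hx4 : ‖x - x₀‖ < ε := hx.trans_le ((min_le_right _ _).trans (min_le_right _ _))
    refine ⟨hδ₁' (by rw [Metric.mem_ball, dist_eq_norm]; exact hx1), hδ₂' x hx2, hδ₃' x hx3,
      fun u hu ↦ hεK ?_⟩
    rw [Metric.mem_ball, Prod.dist_eq, dist_eq_norm, dist_eq_norm]
    exact max_lt hx4 (hu.trans_le ((min_le_right _ _).trans (min_le_right _ _)))
  -- KEY: the pointwise cone inequality `c ‖v‖ ≤ ℓ v` for future causal `v` read at nearby points
  have hkey : ∀ q ∈ φ.source, ‖φ q - x₀‖ < r₀ → ∀ v : E,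
      τ.IsFutureDirected (eT.symmL ℝ q v) → c * ‖v‖ ≤ ℓ v := by
    intro q hq hqx v hv
    obtain ⟨hxt, hGx, hGTx, hKx⟩ := hball₀ (φ q) hqx
    have hqq : φ.symm (φ q) = q := φ.left_inv hq
    have hv' : τ.IsFutureDirected (eT.symmL ℝ (φ.symm (φ q)) v) := by rw [hqq]; exact hv
    have hv'' := (isFutureDirected_symmL_iff hxt v).1 hv'
    have htv : g.coordMetric a (φ q) T₀ v < 0 := by
      rw [g.coordMetric_apply hxt]
      have hT := mem_chartCone_iff.1 (hKx T₀ (by rw [sub_self, norm_zero]; exact hr₀))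
      obtain ⟨hTt, hTf⟩ := mem_futureTimecone_iff.1 hT.2
      exact hTf.val_lt_zero τ hTt hv'
    exact hcone (g.coordMetric a (φ q)) (g.coordMetric a (φ q) T₀) hGx hGTx v hv''.1.1 htv
  -- Step 3: the relative openness of `A` and the slab, as a chart radius `r₂ ≤ r₀`
  set Λ : ℝ := ‖T₀‖ + r₀ + 1 with hΛ
  have hΛpos : 0 < Λ := by positivity
  set κ : ℝ := c * r₀ / (8 * Λ) with hκ
  have hκpos : 0 < κ := by positivity
  obtain ⟨r₂, hr₂, hr₂r₀, hball₂⟩ : ∃ r₂ > 0, r₂ ≤ r₀ ∧ ∀ σ ∈ φ.source, ‖φ σ - x₀‖ < r₂ → σ ∈ S →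
      σ ∈ A ∧ |g.val a ν (φ σ - x₀)| ≤ κ * ‖φ σ - x₀‖ := by
    have hcs : ContinuousAt φ.symm x₀ := continuousAt_extChartAt_symm a
    have hN : {σ | σ ∈ S → σ ∈ A ∧ |g.val a ν (φ σ - x₀)| ≤ κ * ‖φ σ - x₀‖} ∈ 𝓝 (φ.symm x₀) := by
      rw [hsymm₀]
      filter_upwards [hA, hslab κ hκpos] with σ h1 h2
      exact fun hσ ↦ ⟨h1 hσ, h2 hσ⟩
    obtain ⟨r, hr, hrP⟩ := Metric.eventually_nhds_iff.1 (hcs.preimage_mem_nhds hN)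
    refine ⟨min r r₀, lt_min hr hr₀, min_le_right _ _, fun σ hσ hσx hσS ↦ ?_⟩
    have h := hrP (y := φ σ) (by rw [dist_eq_norm]; exact hσx.trans_le (min_le_left _ _))
    have h' : σ ∈ {σ | σ ∈ S → σ ∈ A ∧ |g.val a ν (φ σ - x₀)| ≤ κ * ‖φ σ - x₀‖} := by
      have h'' : φ.symm (φ σ) ∈ {σ | σ ∈ S → σ ∈ A ∧ |g.val a ν (φ σ - x₀)| ≤ κ * ‖φ σ - x₀‖} := h
      rwa [φ.left_inv hσ] at h''
    exact h' hσS
  -- Step 4: the remaining constants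
  set R : ℝ := r₂ / (4 * Λ) with hR
  have hRpos : 0 < R := by positivity
  have hRΛ : R * Λ = r₂ / 4 := by rw [hR]; field_simp
  set r₁ : ℝ := r₀ * R / 2 with hr₁
  have hr₁pos : 0 < r₁ := by positivity
  have hT₀Λ : ‖T₀‖ + r₀ / 2 ≤ Λ := by rw [hΛ]; linarith
  have hsmall : r₁ + R * ‖T₀‖ ≤ r₂ / 4 := by
    have : r₁ + R * ‖T₀‖ = R * (‖T₀‖ + r₀ / 2) := by rw [hr₁]; ring
    rw [this, ← hRΛ]
    exact mul_le_mul_of_nonneg_left hT₀Λ hRpos.le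
  have hsmall₀ : r₁ + R * ‖T₀‖ ≤ r₀ / 4 := hsmall.trans (by linarith)
  have hr₁r₂ : r₁ < r₂ := by
    have : R * ‖T₀‖ ≥ 0 := by positivity
    linarith
  have hr₁r₀ : r₁ < r₀ := lt_of_lt_of_le hr₁r₂ hr₂r₀
  set δ : ℝ := min (r₁ / 2) (c * r₁ / (2 * (‖ℓ‖ + c + 1))) with hδ
  have hδpos : 0 < δ := by positivity
  have hδr₁ : δ < r₁ := (min_le_left _ _).trans_lt (by linarith)
  have hδest : δ * (‖ℓ‖ + c) ≤ c * r₁ / 2 := by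
    have h1 : δ ≤ c * r₁ / (2 * (‖ℓ‖ + c + 1)) := min_le_right _ _
    have h2 : 0 < ‖ℓ‖ + c + 1 := by positivity
    have h3 : δ * (2 * (‖ℓ‖ + c + 1)) ≤ c * r₁ := by
      have := (le_div_iff₀ (by positivity : (0 : ℝ) < 2 * (‖ℓ‖ + c + 1))).1 h1
      linarith
    nlinarith [norm_nonneg ℓ]
  -- Step 5: a point `p ∈ I⁺(S ∖ A)` with `‖φ p - x₀‖ < δ`
  have hN₀ : {q | q ∈ φ.source ∧ ‖φ q - x₀‖ < δ} ∈ 𝓝 a := by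
    have h1 : φ.source ∈ 𝓝 a := extChartAt_source_mem_nhds a
    have h2 : φ ⁻¹' Metric.ball x₀ δ ∈ 𝓝 a :=
      (continuousAt_extChartAt (I := I) a).preimage_mem_nhds (Metric.ball_mem_nhds x₀ hδpos)
    filter_upwards [h1, h2] with q hq1 hq2
    exact ⟨hq1, by rw [← dist_eq_norm]; exact hq2⟩
  obtain ⟨p, ⟨hpsrc, hpδ⟩, hpI⟩ := mem_closure_iff_nhds.1 hcl _ hN₀
  obtain ⟨b, ⟨hbS, hbA⟩, γ, a', b', hab', hγ, hγa, hγb⟩ := hpI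
  have hγcont : ∀ s ∈ Icc a' b', ContinuousAt γ s := fun s hs ↦ (hγ s hs).1.continuousAt
  -- the closed chart ball `K` of radius `r₁`
  have hcb : Metric.closedBall x₀ r₁ ⊆ φ.target := fun x hx ↦
    (hball₀ x (by rw [← dist_eq_norm]; exact (Metric.mem_closedBall.1 hx).trans_lt hr₁r₀)).1
  set K : Set M := φ.symm '' Metric.closedBall x₀ r₁ with hK
  have hKmem : ∀ q, q ∈ K ↔ q ∈ φ.source ∧ ‖φ q - x₀‖ ≤ r₁ := by
    intro q
    constructor
    · rintro ⟨x, hx, rfl⟩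
      refine ⟨φ.map_target (hcb hx), ?_⟩
      rw [φ.right_inv (hcb hx), ← dist_eq_norm]
      exact Metric.mem_closedBall.1 hx
    · rintro ⟨hq, hqx⟩
      exact ⟨φ q, Metric.mem_closedBall.2 (by rw [dist_eq_norm]; exact hqx), φ.left_inv hq⟩
  have hKcl : IsClosed K :=
    ((isCompact_closedBall x₀ r₁).image_of_continuousOn
      ((continuousOn_extChartAt_symm a).mono hcb)).isClosed
  have hbK : b ∉ K := fun hbK' ↦ by
    obtain ⟨hb1, hb2⟩ := (hKmem b).1 hbK'
    exact hbA (hball₂ b hb1 (hb2.trans_lt hr₁r₂) hbS).1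
  have hpK : p ∈ K := (hKmem p).2 ⟨hpsrc, (hpδ.trans hδr₁).le⟩
  -- the last parameter at which `γ` is outside `K`
  set Bad : Set ℝ := {s | s ∈ Icc a' b' ∧ γ s ∉ K} with hBad
  have ha'Bad : a' ∈ Bad := ⟨left_mem_Icc.2 hab'.le, by rw [hγa]; exact hbK⟩
  have hBadne : Bad.Nonempty := ⟨a', ha'Bad⟩
  have hBadbdd : BddAbove Bad := ⟨b', fun s hs ↦ hs.1.2⟩
  set sStar : ℝ := sSup Bad with hsStar
  have ha's : a' ≤ sStar := le_csSup hBadbdd ha'Bad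
  have hsb' : sStar ≤ b' := csSup_le hBadne fun s hs ↦ hs.1.2
  have hsI : sStar ∈ Icc a' b' := ⟨ha's, hsb'⟩
  set e : M := γ sStar with he_def
  -- (α) `e ∈ K`
  have heK : e ∈ K := by
    by_contra heK
    have hnear : ∀ᶠ s in 𝓝 sStar, γ s ∉ K :=
      (hγcont sStar hsI).preimage_mem_nhds (hKcl.isOpen_compl.mem_nhds heK)
    obtain ⟨ε', hε', hε'P⟩ := Metric.eventually_nhds_iff.1 hnear
    rcases hsb'.eq_or_lt with hsb | hsb
    · apply heK
      rw [he_def, hsb, hγb]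
      exact hpK
    · set s : ℝ := min (sStar + ε' / 2) b' with hs
      have hs1 : sStar < s := lt_min (by linarith) hsb
      have hs2 : s ∈ Icc a' b' := ⟨ha's.trans hs1.le, min_le_right _ _⟩
      have hs3 : dist s sStar < ε' := by
        rw [Real.dist_eq, abs_of_pos (by linarith)]
        have : s ≤ sStar + ε' / 2 := min_le_left _ _
        linarith
      have hsBad : s ∈ Bad := ⟨hs2, hε'P hs3⟩
      exact (lt_irrefl _ (hs1.trans_le (le_csSup hBadbdd hsBad)))
  obtain ⟨hesrc, hex⟩ := (hKmem e).1 heK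
  -- (β) `r₁ ≤ ‖φ e - x₀‖`
  have hge : r₁ ≤ ‖φ e - x₀‖ := by
    by_contra hlt
    push Not at hlt
    have hO : IsOpen {q | q ∈ φ.source ∧ ‖φ q - x₀‖ < r₁} := by
      have h := (continuousOn_extChartAt a (I := I)).isOpen_inter_preimage
        (isOpen_extChartAt_source a) (Metric.isOpen_ball (x := x₀) (ε := r₁))
      convert h using 1
      ext q
      simp only [mem_setOf_eq, mem_inter_iff, mem_preimage, Metric.mem_ball, dist_eq_norm]
      rfl
    have hnear : ∀ᶠ s in 𝓝 sStar, γ s ∈ {q | q ∈ φ.source ∧ ‖φ q - x₀‖ < r₁} :=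
      (hγcont sStar hsI).preimage_mem_nhds (hO.mem_nhds ⟨hesrc, hlt⟩)
    obtain ⟨ε', hε', hε'P⟩ := Metric.eventually_nhds_iff.1 hnear
    have hinK : ∀ s, dist s sStar < ε' → γ s ∈ K := fun s hs ↦
      (hKmem _).2 ⟨(hε'P hs).1, (hε'P hs).2.le⟩
    rcases ha's.eq_or_lt with has | has
    · have := hinK a' (by rw [← has, dist_self]; exact hε')
      rw [hγa] at this
      exact hbK this
    · obtain ⟨s, hsBad, hs⟩ := exists_lt_of_lt_csSup hBadne (show sStar - ε' < sStar by linarith)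
      have hsle : s ≤ sStar := le_csSup hBadbdd hsBad
      have hds : dist s sStar < ε' := by
        rw [Real.dist_eq, abs_of_nonpos (by linarith)]
        linarith
      exact hsBad.2 (hinK s hds)
  -- (γ) beyond `sStar` the curve stays in `K`
  have hγK : ∀ s ∈ Icc sStar b', γ s ∈ K := by
    intro s hs
    rcases hs.1.eq_or_lt with h | h
    · rw [← h]; exact heK
    · by_contra hsK
      have hsBad : s ∈ Bad := ⟨⟨ha's.trans hs.1, hs.2⟩, hsK⟩
      exact (lt_irrefl _ (h.trans_le (le_csSup hBadbdd hsBad)))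
  -- Step 6: the cone estimate along `γ|[sStar, b']`
  set xc : ℝ → E := fun s ↦ φ (γ s) with hxc
  set wc : ℝ → E := fun s ↦ eT.continuousLinearMapAt ℝ (γ s) (velocity I γ s) with hwc
  have hγsrc : ∀ s ∈ Icc sStar b', γ s ∈ φ.source := fun s hs ↦ ((hKmem _).1 (hγK s hs)).1
  have hderiv : ∀ s ∈ Icc sStar b', HasDerivAt xc (wc s) s := by
    intro s hs
    have hs' : s ∈ Icc a' b' := ⟨ha's.trans hs.1, hs.2⟩
    have h := hasDerivAt_extChartAt_comp_continuousLinearMapAt (p := a) (hγ s hs').1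
      (by rw [← hsrc_eq]; exact hγsrc s hs)
    exact h
  have hwcone : ∀ s ∈ Icc sStar b', c * ‖wc s‖ ≤ ℓ (wc s) := by
    intro s hs
    have hs' : s ∈ Icc a' b' := ⟨ha's.trans hs.1, hs.2⟩
    obtain ⟨hq1, hq2⟩ := (hKmem _).1 (hγK s hs)
    refine hkey (γ s) hq1 (hq2.trans_lt hr₁r₀) (wc s) ?_
    have hb : γ s ∈ eT.baseSet := by
      rw [heT, TangentBundle.trivializationAt_baseSet, ← hsrc_eq]; exact hq1
    rw [hwc]
    show τ.IsFutureDirected (eT.symmL ℝ (γ s) (eT.continuousLinearMapAt ℝ (γ s) (velocity I γ s)))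
    rw [eT.symmL_continuousLinearMapAt hb]
    exact (hγ s hs').2.2
  have hest : c * ‖xc b' - xc sStar‖ ≤ ℓ (xc b' - xc sStar) :=
    cone_estimate_of_hasDerivAt hc.le hsb' hderiv hwcone
  -- numerics: `ℓ (φ e - x₀) ≤ -c r₁ / 2`
  set z : E := φ e with hz
  have hzx : xc sStar = z := rfl
  have hpx : xc b' = φ p := by show φ (γ b') = φ p; rw [hγb]
  have hzle : ‖z - x₀‖ ≤ r₁ := hex
  have hℓz : ℓ (z - x₀) ≤ -(c * r₁ / 2) := by
    have h1 : ℓ (φ p - x₀) ≤ ‖ℓ‖ * δ := by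
      have := ℓ.le_opNorm (φ p - x₀)
      have h' : ‖ℓ‖ * ‖φ p - x₀‖ ≤ ‖ℓ‖ * δ := mul_le_mul_of_nonneg_left hpδ.le (norm_nonneg _)
      exact (le_abs_self _).trans ((Real.norm_eq_abs _).symm.le.trans (this.trans h'))
    have hge' : r₁ ≤ ‖z - x₀‖ := hge
    have h2 : r₁ - δ ≤ ‖φ p - z‖ := by
      have h5 : ‖z - x₀‖ ≤ ‖z - φ p‖ + ‖φ p - x₀‖ := norm_sub_le_norm_sub_add_norm_sub _ _ _
      rw [norm_sub_rev z (φ p)] at h5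
      linarith
    have h3 : c * (r₁ - δ) ≤ ℓ (φ p - z) := by
      rw [hpx, hzx] at hest
      exact (mul_le_mul_of_nonneg_left h2 hc.le).trans hest
    have h4 : ℓ (z - x₀) = ℓ (φ p - x₀) - ℓ (φ p - z) := by
      rw [← map_sub]; congr 1; abel
    rw [h4]
    linarith [h1, h3, hδest]
  -- Step 7: the vertical chart segment through `e`
  have hvert : ∀ t : ℝ, |t| ≤ R → ‖z + t • T₀ - x₀‖ < r₀ ∧ (z + t • T₀, T₀) ∈ chartCone g τ a := by
    intro t ht
    have hnorm : ‖z + t • T₀ - x₀‖ < r₀ := by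
      have h1 : ‖z + t • T₀ - x₀‖ ≤ ‖z - x₀‖ + ‖t • T₀‖ := by
        rw [← sub_add_eq_add_sub]; exact norm_add_le _ _
      have h2 : ‖t • T₀‖ ≤ R * ‖T₀‖ := by
        rw [norm_smul, Real.norm_eq_abs]; exact mul_le_mul_of_nonneg_right ht (norm_nonneg _)
      linarith only [h1, h2, hzle, hsmall₀, hr₀]
    exact ⟨hnorm, (hball₀ _ hnorm).2.2.2 T₀ (by rw [sub_self, norm_zero]; exact hr₀)⟩
  -- tilted segments from/to `x₀`: the top of the vertical segment is in `I⁺(a)`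
  have htilt : ∀ (z₁ d u : E), 0 < R → d = R • u → ‖u - T₀‖ < r₀ →
      (∀ θ ∈ Icc (0 : ℝ) 1, ‖z₁ + θ • d - x₀‖ < r₀) →
      φ.symm (z₁ + (1 : ℝ) • d) ∈ g.chronologicalFuture τ {φ.symm (z₁ + (0 : ℝ) • d)} := by
    intro z₁ d u hR' hd hu hθ
    refine mem_chronologicalFuture_symm_line (q := a) zero_lt_one fun θ hθ' ↦ ?_
    have h := smul_mem_chartCone ((hball₀ _ (hθ θ hθ')).2.2.2 u hu) hR'
    rw [← hd] at h
    exact h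
  have hzsmall : ∀ t : ℝ, |t| ≤ R → ‖z + t • T₀ - x₀‖ ≤ r₁ + R * ‖T₀‖ := by
    intro t ht
    have h1 : ‖z + t • T₀ - x₀‖ ≤ ‖z - x₀‖ + ‖t • T₀‖ := by
      rw [← sub_add_eq_add_sub]; exact norm_add_le _ _
    have h2 : ‖t • T₀‖ ≤ R * ‖T₀‖ := by
      rw [norm_smul, Real.norm_eq_abs]; exact mul_le_mul_of_nonneg_right ht (norm_nonneg _)
    linarith only [h1, h2, hzle]
  -- (v2) the top `φ⁻¹(z + R T₀)` lies in `I⁺(a)`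
  have hzR : ‖z - x₀‖ / R < r₀ := by
    rw [div_lt_iff₀ hRpos]
    have : r₁ < r₀ * R := by rw [hr₁]; linarith only [mul_pos hr₀ hRpos]
    linarith only [hzle, this]
  have htop : φ.symm (z + R • T₀) ∈ g.chronologicalFuture τ {a} := by
    set u : E := T₀ + R⁻¹ • (z - x₀) with hu
    set d : E := (z - x₀) + R • T₀ with hd
    have hdu : d = R • u := by
      rw [hu, hd, smul_add, smul_inv_smul₀ hRpos.ne']; exact add_comm _ _
    have hunorm : ‖u - T₀‖ < r₀ := by
      rw [hu, add_sub_cancel_left, norm_smul, norm_inv,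
        Real.norm_eq_abs, abs_of_pos hRpos, ← div_eq_inv_mul]
      exact hzR
    have hθ : ∀ θ ∈ Icc (0 : ℝ) 1, ‖x₀ + θ • d - x₀‖ < r₀ := by
      intro θ hθ
      rw [add_sub_cancel_left, norm_smul, Real.norm_eq_abs, abs_of_nonneg hθ.1]
      have hd1 : ‖d‖ ≤ r₁ + R * ‖T₀‖ := by
        have := hzsmall R (by rw [abs_of_pos hRpos])
        rwa [show z + R • T₀ - x₀ = d by rw [hd, sub_add_eq_add_sub]] at this
      have : θ * ‖d‖ ≤ ‖d‖ := mul_le_of_le_one_left (norm_nonneg d) hθ.2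
      linarith only [this, hd1, hsmall₀, hr₀]
    have h := htilt x₀ d u hRpos hdu hunorm hθ
    rw [zero_smul, add_zero, one_smul, show (extChartAt I a).symm x₀ = a from hsymm₀,
      show x₀ + d = z + R • T₀ by rw [hd]; abel] at h
    exact h
  -- (v3) the bottom `φ⁻¹(z - R T₀)` lies in `I⁻(a)`
  have hbot : φ.symm (z + (-R) • T₀) ∈ g.chronologicalPast τ {a} := by
    set u : E := T₀ - R⁻¹ • (z - x₀) with hu
    set d : E := R • T₀ - (z - x₀) with hd
    set z₁ : E := z + (-R) • T₀ with hz₁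
    have hdu : d = R • u := by
      rw [hu, hd, smul_sub, smul_inv_smul₀ hRpos.ne']
    have hunorm : ‖u - T₀‖ < r₀ := by
      rw [hu, sub_sub_cancel_left, norm_neg, norm_smul,
        norm_inv, Real.norm_eq_abs, abs_of_pos hRpos, ← div_eq_inv_mul]
      exact hzR
    have hθ : ∀ θ ∈ Icc (0 : ℝ) 1, ‖z₁ + θ • d - x₀‖ < r₀ := by
      intro θ hθ
      have h1 : ‖z₁ - x₀‖ ≤ r₁ + R * ‖T₀‖ := hzsmall (-R) (by rw [abs_neg, abs_of_pos hRpos])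
      have hd1 : ‖d‖ ≤ r₁ + R * ‖T₀‖ := by
        have h2 : ‖d‖ ≤ ‖R • T₀‖ + ‖z - x₀‖ := norm_sub_le _ _
        rw [norm_smul, Real.norm_eq_abs, abs_of_pos hRpos] at h2
        linarith only [h2, hzle]
      have h3 : ‖z₁ + θ • d - x₀‖ ≤ ‖z₁ - x₀‖ + ‖θ • d‖ := by
        rw [← sub_add_eq_add_sub]; exact norm_add_le _ _
      have h4 : ‖θ • d‖ ≤ ‖d‖ := by
        rw [norm_smul, Real.norm_eq_abs, abs_of_nonneg hθ.1]
        exact mul_le_of_le_one_left (norm_nonneg d) hθ.2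
      linarith only [h1, hd1, h3, h4, hsmall₀, hr₀]
    have h := htilt z₁ d u hRpos hdu hunorm hθ
    have hsum : z₁ + d = x₀ := by simp only [hz₁, hd, neg_smul]; abel
    rw [zero_smul, add_zero, one_smul, hsum, show (extChartAt I a).symm x₀ = a from hsymm₀] at h
    exact mem_chronologicalPast_of_mem_chronologicalFuture h
  -- (v4) the vertical segment is a timelike curve from `I⁻(S)` to `I⁺(S)`: it crosses `S`
  have hVcurve : g.IsFutureTimelikeCurveOn τ (φ.symm ∘ fun t ↦ z + t • T₀) (Icc (-R) R) :=
    isFutureTimelikeCurveOn_symm_line fun t ht ↦ (hvert t (abs_le.2 ht)).2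
  obtain ⟨te, hte, hσS⟩ := IsCauchyHypersurface.exists_mem_of_segment hn hS
    (by linarith only [hRpos]) hVcurve
    (chronologicalFuture_mono (τ := τ.reverse) (singleton_subset_iff.2 haS) hbot)
    (chronologicalFuture_mono (singleton_subset_iff.2 haS) htop)
  set σ : M := φ.symm (z + te • T₀) with hσ_def
  have hteR : |te| ≤ R := abs_le.2 hte
  have hσt : z + te • T₀ ∈ φ.target := (hball₀ _ (hvert te hteR).1).1
  have hσsrc : σ ∈ φ.source := φ.map_target hσt
  have hφσ : φ σ = z + te • T₀ := φ.right_inv hσt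
  -- (v5) the slab estimate at `σ` forces `te > 0`
  have hσx : ‖φ σ - x₀‖ < r₂ := by
    rw [hφσ]; linarith only [hzsmall te hteR, hsmall, hr₂]
  obtain ⟨-, hslabσ⟩ := hball₂ σ hσsrc hσx hσS
  have hte_pos : 0 < te := by
    rw [hφσ] at hslabσ
    have h1 : |g.val a ν (z + te • T₀ - x₀)| ≤ κ * (R * Λ) := by
      refine hslabσ.trans (mul_le_mul_of_nonneg_left ?_ hκpos.le)
      have := hzsmall te hteR
      have h' : r₁ + R * ‖T₀‖ ≤ R * Λ := by rw [hRΛ]; exact hsmall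
      linarith only [this, h']
    have h2 : g.val a ν (z + te • T₀ - x₀) = -(ℓ (z - x₀)) - te * ℓ T₀ := by
      rw [hℓ, hℓ]
      have e1 : (z + te • T₀ - x₀ : E) = (z - x₀) + te • T₀ := (sub_add_eq_add_sub _ _ _).symm
      have e2 : g.val a ν (z + te • T₀ - x₀) = g.val a ν ((z - x₀) + te • T₀) := congrArg _ e1
      have e3 : g.val a ν ((z - x₀) + te • T₀) = g.val a ν (z - x₀) + g.val a ν (te • T₀) :=
        (g.val a ν).map_add (z - x₀) (te • T₀)
      have e4 : g.val a ν (te • T₀) = te * g.val a ν T₀ := (g.val a ν).map_smul te T₀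
      rw [e2, e3, e4]; ring
    rw [h2] at h1
    have h3 : -(κ * (R * Λ)) ≤ ℓ (z - x₀) + te * ℓ T₀ := by
      have := (abs_le.1 h1).2; linarith only [this]
    have h4 : κ * (R * Λ) = c * r₀ * R / 8 := by
      rw [hκ]; field_simp
    have h5 : c * r₁ / 2 = c * r₀ * R / 4 := by rw [hr₁]; ring
    have hposc : 0 < c * r₀ * R := mul_pos (mul_pos hc hr₀) hRpos
    have h6 : 0 < te * ℓ T₀ := by linarith only [h3, hℓz, h4, h5, hposc]
    exact pos_of_mul_pos_left h6 hℓT₀.le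
  -- (v6) `σ ∈ I⁺(e)`
  have hσe : σ ∈ g.chronologicalFuture τ {e} := by
    have h := mem_chronologicalFuture_symm_line (q := a) (z := z) (v := T₀) (a := 0) (b := te)
      hte_pos (fun t ht ↦ (hvert t (abs_le.2 ⟨by linarith only [ht.1, hRpos], ht.2.trans hte.2⟩)).2)
    rw [zero_smul, add_zero, show (extChartAt I a).symm z = e from φ.left_inv hesrc] at h
    exact h
  -- (v7) `σ ∈ I⁺(b)`: contradiction with the achronality of `S`
  have hσb : σ ∈ g.chronologicalFuture τ {b} := by
    rcases ha's.eq_or_lt with h | h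
    · have : e = b := by rw [he_def, ← h, hγa]
      rwa [this] at hσe
    · have heb : e ∈ g.chronologicalFuture τ {b} :=
        ⟨b, rfl, γ, a', sStar, h, hγ.mono (Icc_subset_Icc le_rfl hsb'), hγa, rfl⟩
      exact mem_chronologicalFuture_trans heb hσe
  exact hAc b hbS σ hσS hσb

/-- **Time dual**: under the same hypotheses `a ∉ closure (I⁻(S ∖ A))` (apply the future version
to `τ.reverse` and the future timelike vector `-ν`).
[cite: ONeillSemiRiemannian1983, Ch. 14, Lemma 14.43 (p. 425); HawkingEllis1973CUP, §6.5] -/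
theorem not_mem_closure_chronologicalPast_sdiff (hn : 2 ≤ n) {S A : Set M}
    (hS : g.IsCauchyHypersurface τ S) {a : M} (haS : a ∈ S) {ν : TangentSpace I a}
    (hνt : g.IsTimelike ν) (hνf : τ.IsFutureDirected ν)
    (hA : ∀ᶠ σ in 𝓝 a, σ ∈ S → σ ∈ A)
    (hslab : ∀ κ : ℝ, 0 < κ → ∀ᶠ σ in 𝓝 a, σ ∈ S →
      |g.val a ν (extChartAt I a σ - extChartAt I a a)| ≤
        κ * ‖extChartAt I a σ - extChartAt I a a‖) :
    a ∉ closure (g.chronologicalPast τ (S \ A)) := by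
  have hνt' : g.IsTimelike (-ν) := (g.isTimelike_neg_iff _).2 hνt
  have hνf' : τ.reverse.IsFutureDirected (-ν) := by
    rw [TimeOrientation.isFutureDirected_reverse_iff, ← TimeOrientation.isFutureDirected_neg_iff,
      neg_neg]
    exact hνf
  have hslab' : ∀ κ : ℝ, 0 < κ → ∀ᶠ σ in 𝓝 a, σ ∈ S →
      |g.val a (-ν) (extChartAt I a σ - extChartAt I a a)| ≤
        κ * ‖extChartAt I a σ - extChartAt I a a‖ := by
    intro κ hκ
    filter_upwards [hslab κ hκ] with σ hσ hσS
    rw [map_neg, neg_apply, abs_neg]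
    exact hσ hσS
  exact not_mem_closure_chronologicalFuture_sdiff (τ := τ.reverse) hn hS.reverse haS hνt' hνf' hA
    hslab'

/-- **Open pieces of a spacelike Cauchy hypersurface avoid `closure (I⁺(S ∖ A) ∪ I⁻(S ∖ A) ∪ (S ∖ A))`**
— the hypothesis `Disjoint A (closure F)` of `IsCauchyHypersurface.restrict_compl_closure`
(`CauchyPieceDomain.lean`). Hypotheses: `A ⊆ S` contains all points of `S` near each of its
points (`A` relatively open in `S`), and at each `a ∈ A` the Cauchy hypersurface `S` is tangent
to the orthogonal complement of a future timelike vector `ν_a` (the slab condition, satisfied by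
the image of a smooth embedding with unit normal `ν`). Hawking–Ellis 1973, §6.5 (the edge of an
achronal set; `D(S)` for spacelike `S`); O'Neill 1983, Ch. 14, Lemma 14.43.
[cite: ONeillSemiRiemannian1983, Ch. 14, Lemma 14.43 (p. 425); HawkingEllis1973CUP, §6.5] -/
theorem IsCauchyHypersurface.disjoint_closure_of_spacelike (hn : 2 ≤ n) {S A : Set M}
    (hS : g.IsCauchyHypersurface τ S) (hAS : A ⊆ S)
    (hA : ∀ a ∈ A, ∀ᶠ σ in 𝓝 a, σ ∈ S → σ ∈ A)
    (hslab : ∀ a ∈ A, ∃ ν : TangentSpace I a, g.IsTimelike ν ∧ τ.IsFutureDirected ν ∧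
      ∀ κ : ℝ, 0 < κ → ∀ᶠ σ in 𝓝 a, σ ∈ S →
        |g.val a ν (extChartAt I a σ - extChartAt I a a)| ≤
          κ * ‖extChartAt I a σ - extChartAt I a a‖) :
    Disjoint A (closure (g.chronologicalFuture τ (S \ A) ∪ g.chronologicalPast τ (S \ A) ∪
      (S \ A))) := by
  rw [Set.disjoint_left]
  intro a haA hcl
  obtain ⟨ν, hνt, hνf, hsl⟩ := hslab a haA
  rw [closure_union, closure_union] at hcl
  rcases hcl with (h | h) | h
  · exact not_mem_closure_chronologicalFuture_sdiff hn hS (hAS haA) hνt hνf (hA a haA) hsl h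
  · exact not_mem_closure_chronologicalPast_sdiff hn hS (hAS haA) hνt hνf (hA a haA) hsl h
  · -- `a ∉ closure (S ∖ A)`: a neighbourhood of `a` meets `S` only inside `A`
    obtain ⟨x, hxN, hxS, hxA⟩ := mem_closure_iff_nhds.1 h _ (hA a haA)
    exact hxA (hxN hxS)

/-! ### A spacelike Cauchy hypersurface is acausal -/

/-- **A spacelike Cauchy hypersurface is met at most once by every causal curve** (acausality):
if `S` is a Cauchy hypersurface which is spacelike at each of its points in the first-order sense
of `not_mem_closure_chronologicalFuture_sdiff` (a future timelike `ν_a` with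
`|g_a(ν_a, φ σ - φ a)| = o(‖φ σ - φ a‖)` along `S`), then no future causal curve `γ` on `[a, b]`,
`a < b`, has both endpoints on `S`. Proof: if some `γ t₁ ∉ S` then `γ t₁ ∈ I⁺(S)` (or `I⁻(S)`) and
push-up puts `γ b` (or `γ a`) in `I⁺(S)` (`I⁻(S)`), against achronality; if `γ ⊆ S`, the chart
derivative `ŵ ≠ 0` of `φ ∘ γ` at `a` is causal, so `g(ν, ŵ) ≠ 0`, while the slab condition along
`γ s → γ a` forces `g(ν, ŵ) = 0`. O'Neill 1983, Ch. 14, p. 425 (a spacelike Cauchy hypersurface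
is acausal); Hawking–Ellis 1973, §6.5. [cite: ONeillSemiRiemannian1983, Ch. 14, Lemma 14.42 ff. (p. 425)] -/
theorem IsCauchyHypersurface.false_of_isFutureCausalCurveOn_of_spacelike (hn : 2 ≤ n) {S : Set M}
    (hS : g.IsCauchyHypersurface τ S)
    (hslab : ∀ a ∈ S, ∃ ν : TangentSpace I a, g.IsTimelike ν ∧
      ∀ κ : ℝ, 0 < κ → ∀ᶠ σ in 𝓝 a, σ ∈ S →
        |g.val a ν (extChartAt I a σ - extChartAt I a a)| ≤
          κ * ‖extChartAt I a σ - extChartAt I a a‖)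
    {γ : ℝ → M} {a b : ℝ} (hab : a < b) (hγ : g.IsFutureCausalCurveOn τ γ (Icc a b))
    (ha : γ a ∈ S) (hb : γ b ∈ S) : False := by
  have hn1 : (1 : ℕ∞ω) ≤ n := le_trans one_le_two hn
  have hAc : g.IsAchronal τ S := IsCauchyHypersurface.isAchronal_holds hn hS
  by_cases hall : ∀ t ∈ Icc a b, γ t ∈ S
  · -- the curve lies on `S`: contradiction at the initial point through the derivative
    obtain ⟨ν, hνt, hsl⟩ := hslab (γ a) ha
    set φ := extChartAt I (γ a) with hφ
    set eT := trivializationAt E (TangentSpace I) (γ a) with heT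
    have haI : a ∈ Icc a b := left_mem_Icc.2 hab.le
    set w : E := eT.continuousLinearMapAt ℝ (γ a) (velocity I γ a) with hw
    have hd : HasDerivAt (φ ∘ γ) w a :=
      hasDerivAt_extChartAt_comp_continuousLinearMapAt (p := γ a) (hγ a haI).1
        (mem_chart_source H (γ a))
    have hwv : w = velocity I γ a := continuousLinearMapAt_trivializationAt_base (I := I) (γ a) _
    set gν : E →L[ℝ] ℝ := g.val (γ a) ν with hgν
    have hw0 : gν w ≠ 0 := by
      rw [hgν, hwv]
      exact g.val_ne_zero_of_isTimelike_of_isCausal hνt (hγ a haI).2.1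
    set θ : ℝ := |gν w| with hθ
    have hθpos : 0 < θ := abs_pos.2 hw0
    set ε : ℝ := θ / (4 * (‖gν‖ + 1)) with hε
    have hεpos : 0 < ε := by positivity
    set κ : ℝ := θ / (4 * (‖w‖ + ε + 1)) with hκ
    have hκpos : 0 < κ := by positivity
    -- the two eventual estimates near `a`
    have h1 : ∀ᶠ s in 𝓝 a, ‖(φ ∘ γ) s - (φ ∘ γ) a - (s - a) • w‖ ≤ ε * ‖s - a‖ :=
      hd.isLittleO.bound hεpos
    have h2 : ∀ᶠ s in 𝓝 a, γ s ∈ S → |gν (φ (γ s) - φ (γ a))| ≤ κ * ‖φ (γ s) - φ (γ a)‖ :=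
      (hγ a haI).1.continuousAt.eventually (hsl κ hκpos)
    obtain ⟨δ, hδ, hδP⟩ := Metric.eventually_nhds_iff.1 (h1.and h2)
    set s₁ : ℝ := min (a + δ / 2) b with hs₁
    have hs₁a : a < s₁ := lt_min (by linarith) hab
    have hs₁I : s₁ ∈ Icc a b := ⟨hs₁a.le, min_le_right _ _⟩
    have hds : dist s₁ a < δ := by
      rw [Real.dist_eq, abs_of_pos (by linarith)]
      have : s₁ ≤ a + δ / 2 := min_le_left _ _
      linarith
    obtain ⟨hr, hsl'⟩ := hδP hds
    have hslab₁ := hsl' (hall s₁ hs₁I)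
    -- decompose `φ (γ s₁) - φ (γ a) = (s₁ - a) • w + r`
    set r : E := (φ ∘ γ) s₁ - (φ ∘ γ) a - (s₁ - a) • w with hr_def
    have hsa : 0 < s₁ - a := by linarith
    have hr' : ‖r‖ ≤ ε * (s₁ - a) := by
      have : ‖s₁ - a‖ = s₁ - a := by rw [Real.norm_eq_abs, abs_of_pos hsa]
      rw [this] at hr; exact hr
    have hdec : φ (γ s₁) - φ (γ a) = (s₁ - a) • w + r := by
      show φ (γ s₁) - φ (γ a) = (s₁ - a) • w + ((φ ∘ γ) s₁ - (φ ∘ γ) a - (s₁ - a) • w)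
      simp only [comp_apply]; abel
    -- lower bound of the left-hand side, upper bound of the right-hand side
    have hL : (s₁ - a) * θ - ‖gν‖ * (ε * (s₁ - a)) ≤ |gν (φ (γ s₁) - φ (γ a))| := by
      have e1 : gν (φ (γ s₁) - φ (γ a)) = (s₁ - a) * gν w + gν r := by
        rw [hdec, map_add, map_smul, smul_eq_mul]
      rw [e1]
      have e2 : |(s₁ - a) * gν w| = (s₁ - a) * θ := by rw [abs_mul, abs_of_pos hsa, hθ]
      have e3 : |gν r| ≤ ‖gν‖ * (ε * (s₁ - a)) :=
        (Real.norm_eq_abs _ ▸ gν.le_opNorm r).trans (mul_le_mul_of_nonneg_left hr' (norm_nonneg _))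
      have e4 := abs_sub_abs_le_abs_add ((s₁ - a) * gν w) (gν r)
      rw [e2] at e4
      linarith
    have hR : κ * ‖φ (γ s₁) - φ (γ a)‖ ≤ κ * ((s₁ - a) * (‖w‖ + ε)) := by
      refine mul_le_mul_of_nonneg_left ?_ hκpos.le
      rw [hdec]
      refine (norm_add_le _ _).trans ?_
      rw [norm_smul, Real.norm_eq_abs, abs_of_pos hsa]
      nlinarith [hr', norm_nonneg w]
    have hmain : (s₁ - a) * θ - ‖gν‖ * (ε * (s₁ - a)) ≤ κ * ((s₁ - a) * (‖w‖ + ε)) :=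
      hL.trans (hslab₁.trans hR)
    -- divide by `s₁ - a` and contradict `θ > 0`
    have hdiv : θ - ‖gν‖ * ε ≤ κ * (‖w‖ + ε) := by
      have : (s₁ - a) * (θ - ‖gν‖ * ε) ≤ (s₁ - a) * (κ * (‖w‖ + ε)) := by nlinarith [hmain]
      exact le_of_mul_le_mul_left this hsa
    have hb1 : ‖gν‖ * ε ≤ θ / 4 := by
      rw [hε, mul_div_assoc', div_le_div_iff₀ (by positivity) (by positivity)]
      nlinarith [norm_nonneg gν, hθpos]
    have hb2 : κ * (‖w‖ + ε) ≤ θ / 4 := by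
      rw [hκ, div_mul_eq_mul_div, div_le_div_iff₀ (by positivity) (by positivity)]
      nlinarith [norm_nonneg w, hθpos, hεpos]
    linarith
  · -- some point of the curve is off `S`: push-up contradicts achronality
    push Not at hall
    obtain ⟨t₁, ht₁, ht₁S⟩ := hall
    have hta : a < t₁ := lt_of_le_of_ne ht₁.1 fun h ↦ ht₁S (by rw [← h]; exact ha)
    have htb : t₁ < b := lt_of_le_of_ne ht₁.2 fun h ↦ ht₁S (by rw [h]; exact hb)
    rcases hS.mem_chronologicalFuture_union_chronologicalPast hn ht₁S with h | h
    · -- `γ t₁ ∈ I⁺(S)`: then `γ b ∈ I⁺(S)`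
      obtain ⟨s', hs'S, hs'⟩ := by
        rw [chronologicalFuture_eq_biUnion] at h
        simpa only [mem_iUnion, exists_prop] using h
      -- `s' ≪ γ t₁ ≤ γ b`, read for the reversed time orientation: `γ b ≤' γ t₁ ≪' s'`
      have h1 : γ t₁ ∈ g.causalFuture τ.reverse {γ b} := by
        show γ t₁ ∈ g.causalPast τ {γ b}
        exact mem_causalPast_singleton_iff.2
          (Or.inr ⟨γ t₁, rfl, γ, t₁, b, htb, hγ.mono (Icc_subset_Icc ht₁.1 le_rfl), rfl, rfl⟩)
      have h2 : s' ∈ g.chronologicalFuture τ.reverse {γ t₁} :=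
        mem_chronologicalPast_of_mem_chronologicalFuture hs'
      have h3 : s' ∈ g.chronologicalFuture τ.reverse {γ b} :=
        mem_chronologicalFuture_of_mem_causalFuture hn1 h1 h2
      exact hAc s' hs'S (γ b) hb (mem_chronologicalFuture_of_mem_chronologicalPast h3)
    · -- `γ t₁ ∈ I⁻(S)`: then `γ a ∈ I⁻(S)`
      obtain ⟨s', hs'S, hs'⟩ := by
        rw [chronologicalPast, chronologicalFuture_eq_biUnion] at h
        simpa only [mem_iUnion, exists_prop] using h
      have h1 : γ t₁ ∈ g.causalFuture τ {γ a} :=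
        Or.inr ⟨γ a, rfl, γ, a, t₁, hta, hγ.mono (Icc_subset_Icc le_rfl ht₁.2), rfl, rfl⟩
      have h2 : s' ∈ g.chronologicalFuture τ {γ t₁} :=
        mem_chronologicalFuture_of_mem_chronologicalPast hs'
      exact hAc (γ a) ha s' hs'S (mem_chronologicalFuture_of_mem_causalFuture hn1 h1 h2)

end Main

end LorentzianMetric

end Literature.Geometry.Lorentzian

end
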